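import Summits.AtomisticToContinuum.Crystallization.Theorems.ChartedZeroExcessLayeredLatticeLiouvilleZZZYRCXL
import Summits.AtomisticToContinuum.Crystallization.Theorems.ChartedZeroExcessLayeredLatticeLiouvilleZZZYRCXM
import Mathlib.Data.List.GetD

/-!
# ChartedZeroExcessLayeredLatticeLiouville · ZZZYRCXN — THE θ⁰ KERNEL, DECODE KIT (kernel side, RCX-free)
(decomp-a2c hand-1 g55; target stmt-AtomisticToContinuum-26636 JS-D near reader; critic r1852 (C)(iii), r1854 (A): the typed work remaining
for `KernelSlabSound` = decode bridge + table reading + completeness assembly; this file is the half that does not mention lens-2's RCX)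

§1 the pieces of a chord as an INDEXED family (`piecesFrom a cs` = consecutive nodes of `a :: cs.map dec3`: length, `getElem?`, the
range-sum form `sum_map_piecesFrom` — lens-2's `Σ_{i < chordNp}` — and «every code is some piece's target»); the last code (`lastD_mem`).
§2 codes: `dec3` is injective, and a decoded first coordinate `< 1201` forces the code below `1201³` (so the walk's range facts bound every code).
§3 the period: for `p ∣ 612` the kernel's shifted letter index `(m + 600 + 12) % p` IS `m mod p` (`layer_emod`) — the bridge `regN ↔ regW`.
§4 ★ NO TRUNCATION: a certified piece (`n9 ≤ P9 ≤ 2·10⁶`, letters `≤ 2`) has `|Δγ₀|, |Δγ₁|, |Δm| ≤ 600`, so the ℕ key code `keyN` carries the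
signed key faithfully (`piece_offsets`).
§5 the window locator has a window for every `u9 ∈ (κ₀, κ_last]` (`slabIdx_exists`, no sortedness), and sorted cut points have disjoint windows
(`slabIdx_eq_of_mem_window`).
§6 the box triples (`mem_boxTriples`) and the pigeonhole cover with `card ≤` (`cover_of_card_le_map`: no `Nodup` of the scanned list needed).
Imports RCXL + RCXM (+ `Mathlib.Data.List.GetD`); 0 sorry.  All `[folklore]`.
-/

namespace Summit.AtomisticToContinuum.Crystallization.Theorems.ChartedZeroExcessLayeredLatticeLiouville.ThetaKernel

open scoped BigOperators

/-! ## §1 pieces as an indexed family -/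

/-- a chord with `n` codes has `n` pieces. [folklore] -/
theorem length_piecesFrom : ∀ (cs : List ℕ) (a : ℕ × ℕ × ℕ), (piecesFrom a cs).length = cs.length
  | [], _ => rfl
  | c :: rest, a => by rw [piecesFrom_cons, List.length_cons, List.length_cons, length_piecesFrom rest]

/-- ★ piece `i` runs from node `i` to node `i + 1` of the node list `a :: cs.map dec3` (any default `d`). [folklore] -/
theorem getElem?_piecesFrom : ∀ (cs : List ℕ) (a d : ℕ × ℕ × ℕ) (i : ℕ), i < cs.length →
    (piecesFrom a cs)[i]? = some ((a :: cs.map dec3).getD i d, (cs.map dec3).getD i d)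
  | [], _, _, _, h => absurd h (Nat.not_lt_zero _)
  | c :: rest, a, d, 0, _ => by simp [piecesFrom_cons]
  | c :: rest, a, d, i + 1, h => by
    rw [piecesFrom_cons, List.getElem?_cons_succ, getElem?_piecesFrom rest (dec3 c) d i (by simpa using h)]
    simp

/-- hence the node-form piece `i < n` is a member of `piecesFrom`. [folklore] -/
theorem nodePiece_mem_piecesFrom (cs : List ℕ) (a d : ℕ × ℕ × ℕ) {i : ℕ} (hi : i < cs.length) :
    ((a :: cs.map dec3).getD i d, (cs.map dec3).getD i d) ∈ piecesFrom a cs :=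
  List.mem_of_getElem? (getElem?_piecesFrom cs a d i hi)

/-- ★ THE RANGE-SUM FORM: a sum over the pieces is the sum over `i < n` of the node-form pieces (lens-2's `Σ_{i ∈ range (chordNp c)}`).
[folklore] -/
theorem sum_map_piecesFrom {M : Type*} [AddCommMonoid M] (g : (ℕ × ℕ × ℕ) × (ℕ × ℕ × ℕ) → M) (d : ℕ × ℕ × ℕ) :
    ∀ (cs : List ℕ) (a : ℕ × ℕ × ℕ),
    ((piecesFrom a cs).map g).sum = ∑ i ∈ Finset.range cs.length, g ((a :: cs.map dec3).getD i d, (cs.map dec3).getD i d)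
  | [], _ => by simp [piecesFrom_nil]
  | c :: rest, a => by
    rw [piecesFrom_cons, List.map_cons, List.sum_cons, List.length_cons, Finset.sum_range_succ', sum_map_piecesFrom g d rest (dec3 c),
      add_comm]
    simp

/-- every code of the chord is the target of some piece. [folklore] -/
theorem exists_mem_piecesFrom : ∀ (cs : List ℕ) (a : ℕ × ℕ × ℕ), ∀ y ∈ cs, ∃ b, (b, dec3 y) ∈ piecesFrom a cs
  | [], _, y, hy => by simp at hy
  | c :: rest, a, y, hy => by
    rw [piecesFrom_cons]
    rcases List.mem_cons.mp hy with rfl | hy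
    · exact ⟨a, List.mem_cons.mpr (Or.inl rfl)⟩
    · obtain ⟨b, hb⟩ := exists_mem_piecesFrom rest (dec3 c) y hy
      exact ⟨b, List.mem_cons.mpr (Or.inr hb)⟩

/-- unfolding `lastD` on a cons. [folklore] -/
theorem lastD_cons (c : ℕ) (rest : List ℕ) (d : ℕ) : lastD (c :: rest) d = lastD rest c := rfl

/-- the last code of a nonempty chord is one of its codes. [folklore] -/
theorem lastD_mem : ∀ (cs : List ℕ) (d : ℕ), cs ≠ [] → lastD cs d ∈ cs
  | [], _, h => absurd rfl h
  | c :: rest, d, _ => by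
    rw [lastD_cons]
    by_cases hr : rest = []
    · subst hr; simp [lastD]
    · exact List.mem_cons.mpr (Or.inr (lastD_mem rest c hr))

/-- the last code is the last node: `lastD cs d = (cs.map dec3)`'s last entry, in `getD` form at index `n − 1`. [folklore] -/
theorem getD_length_sub_one_eq_lastD : ∀ (cs : List ℕ) (d : ℕ), cs ≠ [] → cs.getD (cs.length - 1) 0 = lastD cs d
  | [], _, h => absurd rfl h
  | c :: rest, d, _ => by
    rw [lastD_cons]
    by_cases hr : rest = []
    · subst hr; simp [lastD]
    · have hl : 0 < rest.length := List.length_pos_iff.mpr hr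
      rw [List.length_cons, Nat.add_sub_cancel, ← getD_length_sub_one_eq_lastD rest c hr]
      obtain ⟨k, hk⟩ := Nat.exists_eq_add_of_lt hl
      rw [hk, Nat.zero_add, Nat.add_sub_cancel, List.getD_cons_succ]

/-! ## §2 codes -/

/-- `dec3` is injective (a code is `(c / 1201²)·1201² + (c / 1201 % 1201)·1201 + c % 1201`). [folklore] -/
theorem dec3_inj {c c' : ℕ} (h : dec3 c = dec3 c') : c = c' := by
  simp only [dec3, Prod.mk.injEq] at h
  omega

/-- a decoded first coordinate below `1201` bounds the code below `1201³` (the walk's range fact ⇒ the guard's code bound). [folklore] -/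
theorem lt_cube_of_dec3 {c : ℕ} (h : (dec3 c).1 < 1201) : c < 1732323601 := by
  simp only [dec3] at h
  omega

/-! ## §3 the period -/

/-- ★ for `p ∣ 612`: the signed layer `m = am − 600` has `m mod p = (am + 12) % p` (the kernel's letter index), as integers. [folklore] -/
theorem layer_emod {p : ℕ} (hp : p ∣ 612) (am : ℕ) : ((am : ℤ) - 600) % (p : ℤ) = (((am + 12) % p : ℕ) : ℤ) := by
  obtain ⟨k, hk⟩ := hp
  have h : (am : ℤ) - 600 = ((am : ℤ) + 12) + (p : ℤ) * (-(k : ℤ)) := by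
    have : ((612 : ℕ) : ℤ) = (p : ℤ) * k := by exact_mod_cast hk
    push_cast at this
    linarith
  rw [h, Int.add_mul_emod_self_left]
  push_cast
  rfl

/-- hence its `toNat` is the kernel's index and it is nonnegative. [folklore] -/
theorem layer_emod_toNat {p : ℕ} (hp : p ∣ 612) (am : ℕ) : (((am : ℤ) - 600) % (p : ℤ)).toNat = (am + 12) % p := by
  rw [layer_emod hp am, Int.toNat_natCast]

/-! ## §4 no truncation in the key of a certified piece -/

/-- `|v| ≤ 1633` from `v² ≤ 2 666 689 = 1633²`. [folklore] -/
theorem abs_le_1633 {v : ℤ} (h : v * v ≤ 2666689) : -1633 ≤ v ∧ v ≤ 1633 := by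
  constructor <;> nlinarith [sq_nonneg (v + 1633), sq_nonneg (v - 1633)]

/-- `|v| ≤ 578` from `v² ≤ 334 084 = 578²`. [folklore] -/
theorem abs_le_578 {v : ℤ} (h : v * v ≤ 334084) : -578 ≤ v ∧ v ≤ 578 := by
  constructor <;> nlinarith [sq_nonneg (v + 578), sq_nonneg (v - 578)]

/-- ★ NO TRUNCATION: a piece with `n9 ≤ P9 ≤ 2·10⁶` over a word with letters `≤ 2` has all three index offsets in `[−600, 600]`, so the ℕ
components `b + 600 − a` of `keyN` are exact. [folklore] -/
theorem piece_offsets (w : List ℕ) (p : ℕ) (hw : ∀ x, regN w p x ≤ 2) {P9 : ℕ} (hP9 : P9 ≤ 2000000)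
    (pr : (ℕ × ℕ × ℕ) × (ℕ × ℕ × ℕ)) (h9 : n9Z (vecZ w p pr) ≤ P9) :
    pr.1.1 ≤ pr.2.1 + 600 ∧ pr.2.1 ≤ pr.1.1 + 600 ∧ pr.1.2.1 ≤ pr.2.2.1 + 600 ∧ pr.2.2.1 ≤ pr.1.2.1 + 600 ∧
      pr.1.2.2 ≤ pr.2.2.2 + 600 ∧ pr.2.2.2 ≤ pr.1.2.2 + 600 := by
  obtain ⟨⟨a0, a1, am⟩, ⟨b0, b1, bm⟩⟩ := pr
  have hra := hw am
  have hrb := hw bm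
  simp only [n9Z, vecZ] at h9
  set d : ℤ := (regN w p bm : ℤ) - regN w p am with hd
  have hd2 : -2 ≤ d ∧ d ≤ 2 := by constructor <;> omega
  set v0 : ℤ := 3 * ((b0 : ℤ) - a0) + d with hv0
  set v1 : ℤ := 3 * ((b1 : ℤ) - a1) + d with hv1
  set vm : ℤ := (bm : ℤ) - am with hvm
  have hP : (P9 : ℤ) ≤ 2000000 := by exact_mod_cast hP9
  have hq0 := three_sq_le_four_qhex v0 v1
  have hq1 := three_sq_le_four_qhex v1 v0
  have hmm : 0 ≤ vm * vm := mul_self_nonneg vm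
  have hqq : 0 ≤ v0 * v0 + v0 * v1 + v1 * v1 := by nlinarith [sq_nonneg (2 * v0 + v1), sq_nonneg v1]
  have h0 := abs_le_1633 (v := v0) (by nlinarith)
  have h1 := abs_le_1633 (v := v1) (by nlinarith)
  have hm := abs_le_578 (v := vm) (by nlinarith)
  simp only
  omega

/-! ## §5 the window locator: existence and uniqueness of the window -/

/-- ★ EXISTENCE: every `u9` with `κ₀ < u9 ≤ κ_last` is located in SOME window (no sortedness of the cut points is needed). [folklore] -/
theorem slabIdx_exists : ∀ (rest : List ℕ) (κ u9 : ℕ), κ < u9 → u9 ≤ (κ :: rest).getLast (List.cons_ne_nil κ rest) →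
    ∃ s, slabIdx (κ :: rest) u9 = some s
  | [], κ, u9, h1, h2 => by simp at h2; omega
  | κ' :: rest, κ, u9, h1, h2 => by
    rw [slabIdx_cons_cons]
    have hb : Nat.ble u9 κ = false := by
      cases h : Nat.ble u9 κ with
      | false => rfl
      | true => exact absurd (Nat.ble_eq.mp h) (by omega)
    rw [hb]
    simp only [cond_false]
    cases hb' : Nat.ble u9 κ' with
    | true => exact ⟨0, by simp⟩
    | false =>
      have h1' : κ' < u9 := by
        by_contra hle
        have : Nat.ble u9 κ' = true := Nat.ble_eq.mpr (by omega)
        rw [hb'] at this; exact Bool.false_ne_true this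
      have h2' : u9 ≤ (κ' :: rest).getLast (List.cons_ne_nil κ' rest) := by
        rwa [List.getLast_cons (List.cons_ne_nil κ' rest)] at h2
      obtain ⟨s, hs⟩ := slabIdx_exists rest κ' u9 h1' h2'
      exact ⟨s + 1, by simp [hs]⟩

/-- UNIQUENESS for sorted cut points: if `u9` lies in window `s` (`κ_s < u9 ≤ κ_{s+1}`) and the locator answers `s'`, then `s' = s`. [folklore] -/
theorem slabIdx_eq_of_mem_window {cuts : List ℕ} (hsort : cuts.Pairwise (· < ·)) {u9 s s' : ℕ} (hs : s + 1 < cuts.length)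
    (hlo : cuts.getD s 0 < u9) (hhi : u9 ≤ cuts.getD (s + 1) 0) (h : slabIdx cuts u9 = some s') : s' = s := by
  obtain ⟨hs', hlo', hhi'⟩ := slabIdx_some cuts u9 s' h
  have hmono : ∀ i j, i < j → j < cuts.length → cuts.getD i 0 < cuts.getD j 0 := fun i j hij hj => by
    rw [List.getD_eq_getElem _ _ (hij.trans hj), List.getD_eq_getElem _ _ hj]
    exact List.pairwise_iff_getElem.mp hsort i j (hij.trans hj) hj hij
  by_contra hne
  rcases Nat.lt_or_gt_of_ne hne with hlt | hgt
  · -- `s' < s`: `u9 ≤ κ_{s'+1} ≤ κ_s < u9`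
    have h1 : cuts.getD (s' + 1) 0 ≤ cuts.getD s 0 := by
      rcases Nat.lt_or_ge (s' + 1) s with h | h
      · exact (hmono _ _ h (by omega)).le
      · have : s' + 1 = s := by omega
        rw [this]
    omega
  · have h1 : cuts.getD (s + 1) 0 ≤ cuts.getD s' 0 := by
      rcases Nat.lt_or_ge (s + 1) s' with h | h
      · exact (hmono _ _ h (by omega)).le
      · have : s + 1 = s' := by omega
        rw [this]
    omega

/-! ## §6 the box triples and the pigeonhole cover -/

/-- membership in the scanned box offsets. [folklore] -/
theorem mem_boxTriples {GB MB a b c : ℕ} : (a, b, c) ∈ boxTriples GB MB ↔ a < 2 * GB + 1 ∧ b < 2 * GB + 1 ∧ c < 2 * MB + 1 := by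
  simp only [boxTriples, List.mem_flatMap, List.mem_map, List.mem_range, Prod.mk.injEq]
  constructor
  · rintro ⟨a', ha', b', hb', c', hc', rfl, rfl, rfl⟩; exact ⟨ha', hb', hc'⟩
  · rintro ⟨ha, hb, hc⟩; exact ⟨a, ha, b, hb, c, hc, rfl, rfl, rfl⟩

/-- ★ PIGEONHOLE COVER with `card ≤`: if `L.map f` is duplicate-free, lands in `S`, and `|S| ≤ |L|`, then every element of `S` is `f` of a list
element (the scanned list of window offsets need not be duplicate-free: `S = its toFinset`, `|S| ≤ its length = #chords`). [folklore] -/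
theorem cover_of_card_le_map {α β : Type*} [DecidableEq β] (L : List α) (f : α → β) (S : Finset β) (hnd : (L.map f).Nodup)
    (hin : ∀ x ∈ L, f x ∈ S) (hcard : S.card ≤ L.length) : ∀ s ∈ S, ∃ x ∈ L, f x = s := by
  have hsub : (L.map f).toFinset ⊆ S := fun y hy => by
    obtain ⟨x, hx, rfl⟩ := List.mem_map.mp (List.mem_toFinset.mp hy); exact hin x hx
  have hc : (L.map f).toFinset.card = L.length := by rw [List.toFinset_card_of_nodup hnd, List.length_map]
  have heq : (L.map f).toFinset = S := Finset.eq_of_subset_of_card_le hsub (by rw [hc]; exact hcard)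
  intro s hs
  rw [← heq] at hs
  obtain ⟨x, hx, hfx⟩ := List.mem_map.mp (List.mem_toFinset.mp hs)
  exact ⟨x, hx, hfx⟩

/-- the `toFinset` of a list has at most the list's length many elements (restated in the `getD_countWins` currency: the window set of slab
`s` has at most `countWins[s]` elements). [folklore] -/
theorem card_windowSet_le (w : List ℕ) (mX GB MB : ℕ) (cuts : List ℕ) (s : ℕ) (hs : s + 1 < cuts.length) :
    ((boxTriples GB MB).filter fun abc => slabIdx cuts (u9N w mX GB MB abc.1 abc.2.1 abc.2.2) = some s).toFinset.card ≤
      (countWins w mX GB MB cuts).getD s 0 := by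
  rw [getD_countWins w mX GB MB cuts s hs]
  exact List.toFinset_card_le _

end Summit.AtomisticToContinuum.Crystallization.Theorems.ChartedZeroExcessLayeredLatticeLiouville.ThetaKernel
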